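import Literature.NumberTheory.EllipticCurves.Kim2025.MainIdentityAtAugmentationOPEN
import Literature.NumberTheory.EllipticCurves.Kato2004.DivisibilityInputsFine
import Literature.NumberTheory.EllipticCurves.Kato2004.MainConjectureSkeletonProofs
import Literature.NumberTheory.EllipticCurves.PAdicBSDProofs
import Literature.NumberTheory.EllipticCurves.PAdicLFunctionNeZeroHoldsProofs
import HarnessLib

/-!
# C.-H. Kim, arXiv:2505.09121v1, proof of Thm. 3.19: "(IMC at 𝟙) in the FINE currency ⟺ (IMC at 𝟙)
# with `p`-adic `L`-functions", PROVED over Kato's §17.13 package — the kernel certificate of the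
# dictionary behind `Kim2025.mainIdentityAtAugmentation` ([Proofs] companion; theorems only)

Topic `NumberTheory/EllipticCurves`, sub-directory `Kim2025`; namespace
`Literature.NumberTheory.EllipticCurves.Kim2025`.  Written by the cross-ladder literature-typing layer
(cell `bsd-littype`, seat 09, gen 4).  HONEST FRAMING: THEOREMS ONLY (0 definitions, 0 named facts,
0 `sorry`); nothing about any curve is asserted; BSD is not advanced.  This file certifies IN THE KERNEL
the one non-verbatim step of the tree's definition `Kim2025.mainIdentityAtAugmentation` (file
`MainIdentityAtAugmentationOPEN`, faithfulness verdict "FAITHFUL-as-dictionary" of the typing sheet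
SHEETS-09 §F.3): that definition renders the source's clause (IMC at 𝟙) — printed in the FINE
(`p`-adic-`L`-function-free) currency of statement 3.17,

> `ord_𝔓 ( char_Λ ( H¹_Iw(ℚ, T_f(k−r)) / Λ κ^{Kato,k−r,∞}_1 ) ) = ord_𝔓 ( char_Λ ( Sel₀(ℚ_∞, W_f̄(r))^∨ ) )`
> (statement 3.17, §3.5.3, chunk p0014:L43–L51 of the held text `paper:arxiv-2505.09121`), at the
> augmentation prime `𝔓 = 𝟙`,

— in MAZUR's currency `length_{(T)} X(E/ℚ_∞) = ord_{T=0} L_p(E,T)` for an elliptic curve at a good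
ordinary prime, on the strength of the source's own sentence in the proof of Thm. 3.19 (p0014:L78–L81)

> "The latter two results concern the Iwasawa main conjecture with `p`-adic `L`-functions, which is
> equivalent to Conjecture 3.17 via the global Poitou–Tate duality [kato-euler-systems]."

and of Kato's printed length identity, Astérisque 295 §17.13 p. 280 (held text `paper:url-37fbba0bb64a`,
file p0165): "`length(𝔛_𝔭) − length(Λ_𝔭/(L_{p-adic})) = length(𝐇²(T(k))_𝔭) − length(𝐇¹(T(k))_𝔭/Z(f,T)(k)_𝔭)`",
obtained from the exact sequence (17.13.1) [p. 279, p0164:L18–L29] with (17.13.2)–(17.13.4), Prop. 17.11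
and Thm. 16.6.  Here we PROVE, for every §17.13 package `K : Kato2004.DivisibilityInputs W p f κ γ I D`
carrying a fine quotient `π : X(E/ℚ_∞) ↠ Y` exact after `P → X` (the objects of the tree's named
CONSTRUCTION fact `Kato2004.exists_divisibilityInputs_fineQuotient`, whose `Y` is the dual fine Selmer
group `X₀(E/ℚ_∞)` = `WeierstrassCurve.FineSelmerDualData`), under `E[p]` irreducible, `p` odd good
ordinary and `f` the newform of `W`:

* `lengthAt_add_lengthAt_quotient_zeta_eq` — Kato's identity AT `𝔭 = (T)` with the fine quotient in
  place of `𝐇²`: `ℓ_{(T)}(X) + ℓ_{(T)}(𝐇¹/Z) = ord_{T=0} L_p(E,T) + ℓ_{(T)}(Y)` (in `ℕ∞`);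
* `mainIdentityAtAugmentation_iff_fine` — **`Kim2025.mainIdentityAtAugmentation W p f D ↔
  ℓ_{(T)}(𝐇¹_Γ(T_pW)/Z) = ℓ_{(T)}(Y)`**: Mazur's identity at `𝟙` ⟺ the printed fine identity at `𝟙`
  for the package's zeta submodule `Z = K.Z`;
* the two one-way forms and the `FineSelmerDualData` instance
  (`mainIdentityAtAugmentation_iff_fine_of_fineQuotient`, consuming the named fact
  `Kato2004.exists_divisibilityInputs_fineQuotient` by name).

READING of `Z` (the only dictionary line left to the reader, cited): the package's `K.Z` transcribes
Kato's `Z` of Thm. 12.6 [p. 222, p0107:L21–L28] ("`Z ⊂ Z(f,T)` and `Z(f,T)/Z` is a finite group"),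
`Z(f,T)` being "the `Λ`-submodule of `𝐇¹(T) ⊗ ℚ` generated by `z_γ^{(p)}` for all `γ ∈ T`"
[Thm. 12.5 (4), p0107:L10–L11], projected to the `Δ`-trivial component (`DivisibilityInputs` module
docstring); Kim's `Λ κ^{Kato,∞}_1 = Λ · z^{Kato}_{ℚ_∞,γ}` for `γ = γ⁺ + γ⁻` with `T^± = 𝒪γ^±`
(Def. 3.2, p0011:L55–L60; Thm. 3.15) has the same localisations at height-one primes as `Z(f,T)`
(`O_λ`-linearity of `γ ↦ z_γ` and `z_{ι(γ)} = σ_{−1} z_γ`, Thm. 12.5 (1) p. 221, so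
`Z(f,T) = Λ z_{γ⁺} + Λ z_{γ⁻} = Λ z_γ` for `p` odd), hence as `Z` (finite index).  So local lengths of
`𝐇¹/Z` at height-one primes are those of Kim's `H¹_Iw/Λκ₁^∞` — a reading of print, not a kernel fact
(the package pins `Z` only through its printed properties; see `DivisibilityInputs`, "what it does NOT
pin").  Scope: good ORDINARY `p` only (the package lives there); at non-ordinary `p` the fine identity
has no tree carrier (typed GAP Q12 of OPEN-QUESTIONS-09: the canonical `Λ`-adic zeta class is not
pinned in the tree).

Proof ingredients, all tree theorems: `Kato2004.lengthAt_skeleton_identity` (additivity along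
(17.13.1)), `Kato2004.lengthAt_eq_zero_of_finite_of_C_not_mem` (finite modules die at `(T)`:
Prop. 17.11 cokernel, (17.13.4) `𝐇²_loc`), the package field `image_zeta_localized` (p. 280: the
image of `Z_𝔭` in `Λ_𝔭` is `Λ_𝔭·L_p`) turned into an equality of local lengths by the elementary
`lengthAt_quotient_eq_of_localized_eq` below, `exists_iwasawaToPowerSeries_eq_padicLFunction`
(`L_p ∈ Λ` for `E[p]` irreducible, Greenberg–Vatsal Prop. 3.7, PROVED in tree),
`padicLFunction_unitRoot_ne_zero` (Rohrlich, PROVED in tree), `lengthAt_primeT_eq_order_of_charIdeal_eq_span`.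

## References
* C.-H. Kim (app. with R. Pollack), *The refined Tamagawa number conjectures for GL₂*,
  arXiv:2505.09121v1 (2025), statement 3.17 and proof of Thm. 3.19 (§3.5.3), Def. 3.2, Thm. 3.15.
  [Kim2025RefinedTNC] (UNREFEREED preprint — only its dictionary sentence is used, and it is proved here.)
* K. Kato, Astérisque 295 (2004): Thm. 12.5 (pp. 221–222), Thm. 12.6 (p. 222), Thm. 16.6 (p. 271),
  Prop. 17.11 (p. 277), §17.13 (17.13.1)–(17.13.4) (p. 279) and the length identity (p. 280).
  [Kato2004Asterisque]
* R. Greenberg, V. Vatsal, Invent. Math. 142 (2000), Prop. 3.7 (integrality of `L_p`). [GreenbergVatsal2000]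
* L. Washington, *Introduction to Cyclotomic Fields*, §13.2 (`ord_T` of a characteristic power series). [Washington1997]
-/

noncomputable section

open scoped MatrixGroups ModularForm Classical

open CongruenceSubgroup Literature.NumberTheory.EllipticCurves.ModularForms
  Literature.NumberTheory.EllipticCurves Literature.NumberTheory.EllipticCurves.Module
  Literature.NumberTheory.EllipticCurves.IwasawaAlgebra
open Field Literature.NumberTheory.GaloisRepresentations
open Literature.NumberTheory.EllipticCurves.Kato2004
open Literature.NumberTheory.EllipticCurves.Kato2004.EulerSystemValues

universe u

namespace Literature.NumberTheory.EllipticCurves.Kim2025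

/-! ### Algebra: cyclic quotients by ideals that agree after localisation have equal local length -/

section Algebra

variable {R : Type*} [CommRing R]

/-- If `s·J ⊆ I` with `s ∉ 𝔭` then `ℓ_𝔭(R/I) = ℓ_𝔭(R/(I + J))`: the kernel `(I + J)/I` of
`R/I ↠ R/(I + J)` is killed by `s`, so it dies at `𝔭` (NSW (5.1.4) Remark 1: a module killed by
an element outside `𝔭` has trivial localisation at `𝔭`; additivity of length along the localised
short exact sequence). [cite: NeukirchSchmidtWingberg2008, Ch. V §1, (5.1.4) Remark 1] -/
theorem lengthAt_quotient_eq_lengthAt_quotient_sup {I J : Ideal R} {s : R} (𝔭 : PrimeSpectrum R)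
    (hs : s ∉ 𝔭.asIdeal) (hJ : ∀ j ∈ J, s * j ∈ I) :
    lengthAt R (R ⧸ I) 𝔭 = lengthAt R (R ⧸ (I ⊔ J)) 𝔭 := by
  set K : Submodule R (R ⧸ I) := Submodule.map (Submodule.mkQ I) (I ⊔ J) with hK
  have hexact := lengthAt_eq_add_of_exact K.subtype K.mkQ (Submodule.injective_subtype K)
    (Submodule.mkQ_surjective K) (LinearMap.exact_subtype_mkQ K) 𝔭
  have hKs : Module.IsTorsionBy R K s := by
    rintro ⟨x, hx⟩
    obtain ⟨y, hy, rfl⟩ := Submodule.mem_map.mp hx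
    obtain ⟨i, hi, j, hj, rfl⟩ := Submodule.mem_sup.mp hy
    apply Subtype.ext
    change s • Submodule.mkQ I (i + j) = 0
    rw [← map_smul, Submodule.mkQ_apply, Submodule.Quotient.mk_eq_zero, smul_eq_mul, mul_add]
    exact I.add_mem (I.mul_mem_left s hi) (hJ j hj)
  have hK0 : lengthAt R K 𝔭 = 0 := lengthAt_eq_zero_of_isTorsionBy hKs 𝔭 hs
  rw [hexact, hK0, zero_add]
  exact lengthAt_eq_of_linearEquiv (Submodule.quotientQuotientEquivQuotient I (I ⊔ J) le_sup_left) 𝔭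

/-- **Ideals that agree after localisation at `𝔭` have cyclic quotients of the same local length**:
if `s ∉ 𝔭`, `s·J ⊆ I` and `s·I ⊆ J` then `ℓ_𝔭(R/I) = ℓ_𝔭(R/J)` (both equal `ℓ_𝔭(R/(I + J))`;
`I_𝔭 = J_𝔭` as `s` is a unit of `R_𝔭`). [cite: NeukirchSchmidtWingberg2008, Ch. V §1, (5.1.4) Remark 1] -/
theorem lengthAt_quotient_eq_of_localized_eq {I J : Ideal R} {s : R} (𝔭 : PrimeSpectrum R)
    (hs : s ∉ 𝔭.asIdeal) (hJI : ∀ j ∈ J, s * j ∈ I) (hIJ : ∀ i ∈ I, s * i ∈ J) :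
    lengthAt R (R ⧸ I) 𝔭 = lengthAt R (R ⧸ J) 𝔭 := by
  rw [lengthAt_quotient_eq_lengthAt_quotient_sup 𝔭 hs hJI,
    lengthAt_quotient_eq_lengthAt_quotient_sup 𝔭 hs hIJ, sup_comm]

end Algebra

/-- The constant `p = C p` does not lie in the augmentation prime `(T)` of `Λ = ℤ_p⟦T⟧` (its
constant coefficient is `p ≠ 0`; `Λ/(T) ≅ ℤ_p`, Washington §13.2, so `(p)` and `(T)` are distinct
height-one primes). [cite: Washington1997, §13.2] -/
theorem C_natCast_not_mem_primeT (p : ℕ) [Fact p.Prime] :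
    PowerSeries.C (p : ℤ_[p]) ∉ (primeT p).asIdeal := by
  rw [primeT_asIdeal, Ideal.mem_span_singleton, PowerSeries.X_dvd_iff, PowerSeries.constantCoeff_C]
  exact_mod_cast (Fact.out : p.Prime).ne_zero

/-! ### Over Kato's §17.13 package with a fine quotient -/

section Package

variable {p : ℕ} [Fact p.Prime] {W : WeierstrassCurve ℚ} [W.IsElliptic] [W.IsGloballyMinimal]
  [ContinuousSMul ℤ_[p] (W.tateModule p)] {N : ℕ} [NeZero N] {f : CuspForm (Gamma0 N) 2}
  {κ : ZpExtension ℚ p} {γ : absoluteGaloisGroup ℚ}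
  {I : IwasawaH1Data W p κ γ} {D : W.SelmerDualData κ γ}
  {Y : Type u} [AddCommGroup Y] [_root_.Module (IwasawaAlgebra p) Y]

omit [NeZero N] in
/-- **Kato p. 280, "the image of `Z(f,T)_𝔭` is `Λ_𝔭 · L_{p-adic}`", as an equality of local lengths:**
for the package's zeta submodule `Z`, `E[p]` irreducible and `G₁ ∈ Λ` with `ι G₁ = L_p(E,T)`,
`ℓ_𝔭(Λ / col(loc Z)) = ℓ_𝔭(Λ/(G₁))` at every height-one prime `𝔭` (field `image_zeta_localized`:
some `s ∉ 𝔭` multiplies each of `col(loc Z)`, `(G₁)` into the other).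
[cite: Kato2004Asterisque, §17.13 (p. 280), Thm. 16.6 (p. 271) and Prop. 17.11 (p. 277)] -/
theorem lengthAt_quotient_colLocZ_eq (K : DivisibilityInputs W p f κ γ I D)
    (hirr : W.HasIrreducibleModPGaloisRep p) {G₁ : IwasawaAlgebra p}
    (hG₁ : iwasawaToPowerSeries p G₁ = padicLFunction f (unitRoot W p : ℚ_[p]))
    (𝔭 : PrimeSpectrum (IwasawaAlgebra p)) (h𝔭 : 𝔭.asIdeal.height = 1) :
    lengthAt (IwasawaAlgebra p) (IwasawaAlgebra p ⧸ (K.Z.map K.loc).map K.col) 𝔭 =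
      lengthAt (IwasawaAlgebra p) (IwasawaAlgebra p ⧸ Ideal.span {G₁}) 𝔭 := by
  obtain ⟨s, hs, hsG, hsZ⟩ := K.image_zeta_localized hirr G₁ hG₁ 𝔭 h𝔭
  have hM : (K.Z.map K.loc).map K.col = K.Z.map (K.col ∘ₗ K.loc) :=
    (Submodule.map_comp K.loc K.col K.Z).symm
  rw [hM]
  refine lengthAt_quotient_eq_of_localized_eq 𝔭 hs ?_ ?_
  · intro j hj
    obtain ⟨r, rfl⟩ := Ideal.mem_span_singleton'.mp hj
    have : s * (r * G₁) = r • (s * G₁) := by rw [smul_eq_mul]; ring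
    rw [this]
    exact Submodule.smul_mem _ r hsG
  · intro m hm
    obtain ⟨z, hz, rfl⟩ := Submodule.mem_map.mp hm
    simpa using hsZ z hz

omit [NeZero N] in
/-- **`ℓ_𝔭(Y) + ℓ_𝔭(Im ε) = ℓ_𝔭(𝐇²)`** for the fine quotient `π : X ↠ Y` exact after `P → X`:
`Y ≅ X / Im(P) = X / Ker δ ≅ Im δ = Ker ε` ((17.13.1) exact at `X` and at `𝐇²`), and
`0 → Ker ε → 𝐇² → Im ε → 0`. [cite: Kato2004Asterisque, §17.13 (17.13.1) (p. 279)] -/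
theorem lengthAt_fine_add_lengthAt_range_eq (K : DivisibilityInputs W p f κ γ I D)
    (π : D.X →ₗ[IwasawaAlgebra p] Y) (hπs : Function.Surjective π) (hπ : Function.Exact K.toX π)
    (𝔭 : PrimeSpectrum (IwasawaAlgebra p)) :
    lengthAt (IwasawaAlgebra p) Y 𝔭 + lengthAt (IwasawaAlgebra p) (LinearMap.range K.ε) 𝔭 =
      lengthAt (IwasawaAlgebra p) K.H2 𝔭 := by
  have hker : LinearMap.ker π = LinearMap.ker K.δ := by
    rw [LinearMap.exact_iff.mp hπ, LinearMap.exact_iff.mp K.exact_X]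
  have eY : Y ≃ₗ[IwasawaAlgebra p] LinearMap.ker K.ε :=
    (π.quotKerEquivOfSurjective hπs).symm ≪≫ₗ Submodule.quotEquivOfEq _ _ hker ≪≫ₗ
      K.δ.quotKerEquivRange ≪≫ₗ LinearEquiv.ofEq _ _ (LinearMap.exact_iff.mp K.exact_H2).symm
  have hex : Function.Exact (LinearMap.ker K.ε).subtype K.ε.rangeRestrict :=
    LinearMap.exact_iff.mpr (by rw [LinearMap.ker_rangeRestrict, Submodule.range_subtype])
  have h2 := lengthAt_eq_add_of_exact (LinearMap.ker K.ε).subtype K.ε.rangeRestrict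
    (Submodule.injective_subtype _) (LinearMap.surjective_rangeRestrict K.ε) hex 𝔭
  rw [lengthAt_eq_of_linearEquiv eY 𝔭, h2]

omit [NeZero N] in
/-- In particular `ℓ_{(T)}(Y) = ℓ_{(T)}(𝐇²)`: `Im ε ⊆ 𝐇²_loc` is finite ((17.13.4)), so it dies at the
height-one prime `(T) ∌ p`. [cite: Kato2004Asterisque, §17.13 (17.13.4) (p. 279)] -/
theorem lengthAt_fine_primeT_eq (K : DivisibilityInputs W p f κ γ I D)
    (π : D.X →ₗ[IwasawaAlgebra p] Y) (hπs : Function.Surjective π) (hπ : Function.Exact K.toX π) :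
    lengthAt (IwasawaAlgebra p) Y (primeT p) = lengthAt (IwasawaAlgebra p) K.H2 (primeT p) := by
  have h := lengthAt_fine_add_lengthAt_range_eq K π hπs hπ (primeT p)
  haveI := K.finite_H2loc
  haveI : Finite (LinearMap.range K.ε) := Finite.of_injective _ Subtype.val_injective
  rwa [lengthAt_eq_zero_of_finite_of_C_not_mem (LinearMap.range K.ε) (primeT p)
    (C_natCast_not_mem_primeT p), add_zero] at h

omit [W.IsElliptic] [ContinuousSMul ℤ_[p] (W.tateModule p)] [NeZero N] in
/-- **`ℓ_{(T)}(Λ/(G₁)) = ord_{T=0} L_p(E,T)`** for `G₁ ∈ Λ` with `ι G₁ = L_p(E,T) ≠ 0`: `Λ/(G₁)` is a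
finitely generated torsion `Λ`-module with `char = (G₁)`, so its `(T)`-length is `ord_T G₁`
(`lengthAt_primeT_eq_order_of_charIdeal_eq_span`), and `ι` preserves `ord_T`. [cite: Washington1997, §13.2] -/
theorem lengthAt_quotient_span_primeT_eq_order {G₁ : IwasawaAlgebra p}
    (hG₁ : iwasawaToPowerSeries p G₁ = padicLFunction f (unitRoot W p : ℚ_[p]))
    (hL : padicLFunction f (unitRoot W p : ℚ_[p]) ≠ 0) :
    lengthAt (IwasawaAlgebra p) (IwasawaAlgebra p ⧸ Ideal.span {G₁}) (primeT p) =
      (padicLFunction f (unitRoot W p : ℚ_[p])).order := by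
  have hG0 : G₁ ≠ 0 := by
    rintro rfl
    exact hL (by rw [← hG₁, map_zero])
  have hby : Module.IsTorsionBy (IwasawaAlgebra p) (IwasawaAlgebra p ⧸ Ideal.span {G₁}) G₁ :=
    (Module.isTorsionBy_quotient_iff _ G₁).mpr fun y ↦ by
      rw [smul_eq_mul]
      exact Ideal.mul_mem_right y _ (Ideal.mem_span_singleton_self G₁)
  have htor : Module.IsTorsion (IwasawaAlgebra p) (IwasawaAlgebra p ⧸ Ideal.span {G₁}) :=
    fun x ↦ ⟨⟨G₁, mem_nonZeroDivisors_of_ne_zero hG0⟩, @hby x⟩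
  rw [lengthAt_primeT_eq_order_of_charIdeal_eq_span htor
      (charIdeal_eq_span_of_lengthAt_eq_quotient hG0 fun _ _ ↦ rfl),
    ← order_iwasawaToPowerSeries p G₁, hG₁]

omit [NeZero N] in
/-- **Kato's length identity (p. 280) at the augmentation prime, with the FINE quotient in place of
`𝐇²`: `ℓ_{(T)}(X(E/ℚ_∞)) + ℓ_{(T)}(𝐇¹_Γ(T_pW)/Z) = ord_{T=0} L_p(E,T) + ℓ_{(T)}(Y)`** (in `ℕ∞`), for a
§17.13 package `K` with a fine quotient `π : X ↠ Y` exact after `P → X`, `E[p]` irreducible and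
`G₁ ∈ Λ` with `ι G₁ = L_p(E,T) ≠ 0`.  From `lengthAt_skeleton_identity` at `𝔭 = (T)`: the Coleman
cokernel `Λ/col(P)` (Prop. 17.11) and `Im ε ⊆ 𝐇²_loc` ((17.13.4)) are finite, hence of length `0`
at `(T) ∌ p`; `ℓ_{(T)}(Λ/col(loc Z)) = ℓ_{(T)}(Λ/(G₁)) = ord_T L_p`; `ℓ_{(T)}(𝐇²) = ℓ_{(T)}(Y)`.
[cite: Kato2004Asterisque, §17.13 (pp. 279–280), Prop. 17.11 (p. 277), Thm. 16.6 (p. 271)] -/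
theorem lengthAt_add_lengthAt_quotient_zeta_eq (K : DivisibilityInputs W p f κ γ I D)
    (hirr : W.HasIrreducibleModPGaloisRep p) {G₁ : IwasawaAlgebra p}
    (hG₁ : iwasawaToPowerSeries p G₁ = padicLFunction f (unitRoot W p : ℚ_[p]))
    (hL : padicLFunction f (unitRoot W p : ℚ_[p]) ≠ 0)
    (π : D.X →ₗ[IwasawaAlgebra p] Y) (hπs : Function.Surjective π) (hπ : Function.Exact K.toX π) :
    lengthAt (IwasawaAlgebra p) D.X (primeT p) +
        lengthAt (IwasawaAlgebra p) (I.H ⧸ K.Z) (primeT p) =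
      (padicLFunction f (unitRoot W p : ℚ_[p])).order + lengthAt (IwasawaAlgebra p) Y (primeT p) := by
  have h := lengthAt_skeleton_identity K.loc K.loc_injective K.toX K.δ K.ε K.exact_P K.exact_X
    K.exact_H2 K.col K.col_injective K.Z (primeT p)
  haveI := K.finite_coker_col
  haveI := K.finite_H2loc
  haveI : Finite (LinearMap.range K.ε) := Finite.of_injective _ Subtype.val_injective
  have hpT := C_natCast_not_mem_primeT p
  rw [lengthAt_eq_zero_of_finite_of_C_not_mem (IwasawaAlgebra p ⧸ LinearMap.range K.col) (primeT p) hpT,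
    lengthAt_eq_zero_of_finite_of_C_not_mem (LinearMap.range K.ε) (primeT p) hpT, add_zero, add_zero,
    lengthAt_quotient_colLocZ_eq K hirr hG₁ (primeT p) (height_primeT p),
    lengthAt_quotient_span_primeT_eq_order hG₁ hL, ← lengthAt_fine_primeT_eq K π hπs hπ] at h
  exact h

omit [NeZero N] in
/-- **(IMC at 𝟙), Mazur currency ⟺ fine currency, over Kato's package.**  For a §17.13 package `K`
on `(𝐇¹_Γ(T_pW), X(E/ℚ_∞))` with a fine quotient `π : X ↠ Y` exact after `P → X`, `E[p]` irreducible
and `G₁ ∈ Λ` with `ι G₁ = L_p(E,T) ≠ 0`: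
`Kim2025.mainIdentityAtAugmentation W p f D` (`ℓ_{(T)} X = ord_{T=0} L_p(E,T)`) **iff**
`ℓ_{(T)}(𝐇¹_Γ/Z) = ℓ_{(T)}(Y)` — the source's statement 3.17 at `𝔓 = 𝟙` in its own (fine) currency,
for the package's zeta submodule `Z`.  This is the source's sentence "equivalent … via the global
Poitou–Tate duality [Kato]" (proof of Thm. 3.19) made a kernel theorem: both directions are Kato's
p. 280 identity read at `(T)` (`lengthAt_add_lengthAt_quotient_zeta_eq`), the cancelled summands being
finite (`ord_T L_p < ∞` by `L_p ≠ 0`; `ℓ_{(T)}(Y) = ℓ_{(T)}(𝐇²) < ∞`, `𝐇²` finitely generated torsion).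
[cite: Kim2025RefinedTNC, proof of Thm. 3.19 (§3.5.3, chunk p0014:L78–L81) and statement 3.17 (p0014:L43–L51)]
[cite: Kato2004Asterisque, §17.13 (p. 280)] -/
theorem mainIdentityAtAugmentation_iff_fine (K : DivisibilityInputs W p f κ γ I D)
    (hirr : W.HasIrreducibleModPGaloisRep p) {G₁ : IwasawaAlgebra p}
    (hG₁ : iwasawaToPowerSeries p G₁ = padicLFunction f (unitRoot W p : ℚ_[p]))
    (hL : padicLFunction f (unitRoot W p : ℚ_[p]) ≠ 0)
    (π : D.X →ₗ[IwasawaAlgebra p] Y) (hπs : Function.Surjective π) (hπ : Function.Exact K.toX π) :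
    mainIdentityAtAugmentation W p f D ↔
      lengthAt (IwasawaAlgebra p) (I.H ⧸ K.Z) (primeT p) = lengthAt (IwasawaAlgebra p) Y (primeT p) := by
  have h := lengthAt_add_lengthAt_quotient_zeta_eq K hirr hG₁ hL π hπs hπ
  have hfinL : (padicLFunction f (unitRoot W p : ℚ_[p])).order ≠ ⊤ := by
    rwa [Ne, PowerSeries.order_eq_top]
  have hfinY : lengthAt (IwasawaAlgebra p) Y (primeT p) ≠ ⊤ := by
    rw [lengthAt_fine_primeT_eq K π hπs hπ]
    haveI := K.finite_H2
    exact lengthAt_primeT_ne_top K.H2 K.isTorsion_H2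
  rw [mainIdentityAtAugmentation_iff]
  constructor
  · intro hX
    rw [hX] at h
    exact (add_right_inj_of_ne_top hfinL).mp h
  · intro hZ
    rw [hZ] at h
    exact (add_left_inj_of_ne_top hfinY).mp h

omit [NeZero N] in
/-- One-way form: the Mazur identity at `𝟙` gives the fine identity at `𝟙` for the package's `Z`.
[cite: Kim2025RefinedTNC, proof of Thm. 3.19 (§3.5.3, chunk p0014:L78–L81)] [cite: Kato2004Asterisque, §17.13 (p. 280)] -/
theorem lengthAt_quotient_zeta_eq_fine_of_mainIdentityAtAugmentation
    (K : DivisibilityInputs W p f κ γ I D) (hirr : W.HasIrreducibleModPGaloisRep p)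
    {G₁ : IwasawaAlgebra p}
    (hG₁ : iwasawaToPowerSeries p G₁ = padicLFunction f (unitRoot W p : ℚ_[p]))
    (hL : padicLFunction f (unitRoot W p : ℚ_[p]) ≠ 0)
    (π : D.X →ₗ[IwasawaAlgebra p] Y) (hπs : Function.Surjective π) (hπ : Function.Exact K.toX π)
    (hX : mainIdentityAtAugmentation W p f D) :
    lengthAt (IwasawaAlgebra p) (I.H ⧸ K.Z) (primeT p) = lengthAt (IwasawaAlgebra p) Y (primeT p) :=
  (mainIdentityAtAugmentation_iff_fine K hirr hG₁ hL π hπs hπ).mp hX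

omit [NeZero N] in
/-- Other one-way form: the fine identity at `𝟙` for the package's `Z` gives the Mazur identity at `𝟙`.
[cite: Kim2025RefinedTNC, proof of Thm. 3.19 (§3.5.3, chunk p0014:L78–L81)] [cite: Kato2004Asterisque, §17.13 (p. 280)] -/
theorem mainIdentityAtAugmentation_of_fine (K : DivisibilityInputs W p f κ γ I D)
    (hirr : W.HasIrreducibleModPGaloisRep p) {G₁ : IwasawaAlgebra p}
    (hG₁ : iwasawaToPowerSeries p G₁ = padicLFunction f (unitRoot W p : ℚ_[p]))
    (hL : padicLFunction f (unitRoot W p : ℚ_[p]) ≠ 0)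
    (π : D.X →ₗ[IwasawaAlgebra p] Y) (hπs : Function.Surjective π) (hπ : Function.Exact K.toX π)
    (hZ : lengthAt (IwasawaAlgebra p) (I.H ⧸ K.Z) (primeT p) =
      lengthAt (IwasawaAlgebra p) Y (primeT p)) :
    mainIdentityAtAugmentation W p f D :=
  (mainIdentityAtAugmentation_iff_fine K hirr hG₁ hL π hπs hπ).mpr hZ

end Package

/-! ### The instance on the pinned fine Selmer dual, with the hypotheses of the construction fact -/

section FineSelmerDual

variable {p : ℕ} [Fact p.Prime] {W : WeierstrassCurve ℚ} [W.IsElliptic] [W.IsGloballyMinimal]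
  [ContinuousSMul ℤ_[p] (W.tateModule p)] {N : ℕ} [NeZero N] {f : CuspForm (Gamma0 N) 2}
  {κ : ZpExtension ℚ p} {γ : absoluteGaloisGroup ℚ}

/-- **Kim's (IMC at 𝟙) for `E` at an odd good ordinary `p` with `E[p]` irreducible: Mazur currency ⟺
fine currency, on EVERY package of the named construction fact
`Kato2004.exists_divisibilityInputs_fineQuotient`** (Kato (14.9.3)/(17.13.1) with the cokernel of
`P → X` pinned to `X₀(E/ℚ_∞) = Y.X`, `Y : W.FineSelmerDualData κ γ`).  The integral `p`-adic
`L`-function `G₁` (Greenberg–Vatsal Prop. 3.7, tree theorem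
`exists_iwasawaToPowerSeries_eq_padicLFunction`) and `L_p ≠ 0` (Rohrlich, tree theorem
`padicLFunction_unitRoot_ne_zero`) are supplied here, so the statement carries only the hypotheses of
the construction fact plus `Irr(E[p])`: for every `I`, `D`, `Y` there are a package `K` and a fine
quotient `π`, and for THEM `mainIdentityAtAugmentation W p f D ↔ ℓ_{(T)}(𝐇¹_Γ/K.Z) = ℓ_{(T)}(X₀)`.
[cite: Kim2025RefinedTNC, proof of Thm. 3.19 (§3.5.3, chunk p0014:L78–L81) and statement 3.17 (p0014:L43–L51)]
[cite: Kato2004Asterisque, (14.9.3) (p. 240) and §17.13 (pp. 279–280)] [cite: GreenbergVatsal2000, Prop. 3.7] -/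
theorem mainIdentityAtAugmentation_iff_fine_of_fineQuotient
    (hfine : exists_divisibilityInputs_fineQuotient) (hp : p ≠ 2) (hord : IsOrdinaryAt W p)
    (hκ : κ.IsCyclotomic) (hγ : κ.IsTopGenerator γ) (hγ' : IsCyclotomicVariable p γ)
    (hf : IsNewformOf W f) (hirr : W.HasIrreducibleModPGaloisRep p)
    (I : IwasawaH1Data W p κ γ) (D : W.SelmerDualData κ γ) (Y : W.FineSelmerDualData κ γ) :
    ∃ (K : DivisibilityInputs W p f κ γ I D) (π : D.X →ₗ[IwasawaAlgebra p] Y.X),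
      Function.Surjective π ∧ Function.Exact K.toX π ∧
      (mainIdentityAtAugmentation W p f D ↔
        lengthAt (IwasawaAlgebra p) (I.H ⧸ K.Z) (primeT p) =
          lengthAt (IwasawaAlgebra p) Y.X (primeT p)) := by
  obtain ⟨K, π, hπs, hπ⟩ := hfine W p f κ γ hp hord hκ hγ hγ' hf I D Y
  obtain ⟨G₁, hG₁⟩ := exists_iwasawaToPowerSeries_eq_padicLFunction hp hord hf hirr
  exact ⟨K, π, hπs, hπ, mainIdentityAtAugmentation_iff_fine K hirr hG₁
    (padicLFunction_unitRoot_ne_zero hord hf) π hπs hπ⟩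

end FineSelmerDual

end Literature.NumberTheory.EllipticCurves.Kim2025

end
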